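import Summits.QuantumFields.YangMills.Theorems.AlphaInputsT3ACv3LinearLiftSmoothLin
import HarnessLib

/-!
# `AlphaInputsT3ACv3LinearLiftSmoothGauge` — (LL+) ★★ THE LIFT OF A PURE GAUGE IS THE PURE GAUGE OF THE INTERPOLANT, ON THE NOSE: `liftS k (dλ) = d(S0 k λ)` (and `lift k (dλ) = d(S0 k λ)`),
# because the (0.4) coboundary potential of a finest pure gauge is EXPLICIT — `Ψ_s(dg) = Q'_s g − g ∘ toFine s` (Bałaban's `s`-fold site average minus the centre value) — and the spread
# `S0` is an exact RIGHT INVERSE of the `k`-fold site average: `Q'_k (S0 k λ) = λ` — cell `ym3-torus`, width seat `ym-ust-19936-w2` (g2)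

WHY (this seat's PROGRESS 1∕2, 2026-08-28; w1-19936 Newton v2 «no global small gauge on a large Ω»; alpha-2 g5 01:04:57Z (3d) «local log frames … frame changes δh = O(ε) exact:
S¹(dδh) = dS⁰δh»).  A blockwise-gauge construction of the non-abelian fine field compares two local candidates built in two coarse axial frames `h_y`, `h_{y'}`; the frame change
`r = h_y h_{y'}⁻¹ = T·exp(λ)` acts on the coarse data by the coarse pure gauge `dλ` (plus `O(ε²)` commutators), so on the finest level the two candidates differ — to first order — by the
lift of `dλ`.  THIS FILE shows that lift is EXACTLY `d(S0 k λ)` (no `Ψ`-term), with `S0 k λ = λ` at every coarse site (`S0_toFine`): the transition gauge transformation between the two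
candidates is therefore ≡ 1 on `toFine k (T^{(k)})`, i.e. it changes NO `k`-fold (0.4) average (`T4Continuum.iter_gaugeAct`, `transfUp u k = u ∘ embIter k`) and NO plaquette —
the gluing letter of the scheme.
WHAT.  §1 `ptMean_sub`, ★ `ptMean_eq_siteAvg` (the (0.3) block mean IS Bałaban's site average `Q'` of [Balaban1984PropagatorsI] (1.13)); §2 ★★ `psiIter_dgrad :
psiIter s (dgrad g) y = siteAvgIter s g y − g (toFine s y)`; §3 `blockSum_sigma_profiles`, ★★ `siteAvgIter_S0 : siteAvgIter k (S0 k λ) = λ` (biorthogonality for 0-forms); §4 ★★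
`psiIter_S1_dgrad : psiIter k (S1 k (dgrad λ)) = 0`, `S0_zero`, `dgrad_zero'`, ★★★ `liftS_dgrad_eq : liftS k (dgrad λ) = dgrad (S0 k λ)`, ★ `lift_dgrad_eq : lift k (dgrad λ) = dgrad (S0 k λ)`
(the block-constant and the smooth lift AGREE on pure gauges).
HONEST FRAMING.  Finite-dimensional lattice linear algebra over `…LinearLiftSmooth`∕`…SmoothLin` (p592127∕p592508); count-neutral helper toward the (FL) row of 2′∕2′χ
(`--supports stmt-QuantumFields-19936`); (FL)∕`hLift` is NOT proved here; nothing of [Balaban1985UV3]∕[Balaban1985Variational] is asserted; registry untouched.  YM₃ on the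
three-torus is RUNG R3 of the programme, not the Clay problem; no claim about d = 4, infinite volume or a mass gap.

References: T. Bałaban, Commun. Math. Phys. 109 (1987) 249–301 [Balaban1987RG1] ((0.1) p.251, (0.3) p.252, (0.4)+(0.11) p.253); Commun. Math. Phys. 95 (1984) 17–40
[Balaban1984PropagatorsI] ((1.13) p.19, (1.20) p.20).
-/

set_option autoImplicit false

noncomputable section

namespace Summit.QuantumFields.YangMills.Theorems.LinearLiftSpread

open Finset
open Literature.MathematicalPhysics.QuantumFieldTheory.Balaban1983to89
open Literature.MathematicalPhysics.QuantumFieldTheory.Balaban1983to89.B10Eq38TorusDomains (toFine toFine_zero toFine_succ)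
open Literature.MathematicalPhysics.QuantumFieldTheory.Balaban1983to89.LatticeFieldCalculus (siteAvg siteAvgIter)
open Literature.MathematicalPhysics.QuantumFieldTheory.Balaban1983to89.B5Eq118OneStroke (iterBlock siteAvgIter_eq_blockSum)
open Literature.MathematicalPhysics.QuantumFieldTheory.Balaban1983to89.B5Eq117TorusCarriers (blockSiteK sum_iterBlock_eq)
open Literature.MathematicalPhysics.QuantumFieldTheory.Balaban1983to89.BlockAveraging (off Idx)
open Summit.QuantumFields.YangMills.Theorems.AbelianEML (linAvgIter offPt stairMean offPt_off_eq_blockSite)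
open Summit.QuantumFields.YangMills.Theorems.LinearLiftGauge (dgrad ptMean psiIter stairMean_dgrad linAvgIter_dgrad sum_Idx_fst card_Idx)
open Summit.QuantumFields.YangMills.Theorems.LinearLiftProfile

variable {P : Params} {j : ℕ}

/-! ## §1 The (0.3) block mean is Bałaban's site average -/

/-- `ptMean` is linear: subtraction. [cite: Balaban1987RG1, (0.3) p.252 (bookkeeping)] -/
theorem ptMean_sub (g g' : Site P j → ℝ) (y : Site P (j + 1)) : ptMean (g - g') y = ptMean g y - ptMean g' y := by
  unfold ptMean
  simp only [Pi.sub_apply, sum_sub_distrib]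
  ring

/-- **★ THE (0.3) BLOCK MEAN OVER THE INDEX SET IS THE SITE AVERAGE `Q'`**: `ptMean g y = siteAvg g y` (the orderings are idle, the offset points are the block sites).
[cite: Balaban1984PropagatorsI, (1.13) p.19; Balaban1987RG1, (0.3) p.252] -/
theorem ptMean_eq_siteAvg (g : Site P j → ℝ) (y : Site P (j + 1)) : ptMean g y = siteAvg g y := by
  unfold ptMean siteAvg
  have e : ∀ i : Idx P, g (offPt y (off i.1)) = g (Site.blockSite y i.1) := fun i => by rw [offPt_off_eq_blockSite]
  simp_rw [e]
  rw [sum_Idx_fst (fun r => g (Site.blockSite y r)), card_Idx, smul_eq_mul]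
  have hL : (0 : ℝ) < (P.L : ℝ) ^ P.d := pow_pos (Nat.cast_pos.mpr P.L_pos) _
  have hc : (0 : ℝ) < Fintype.card (Equiv.Perm (Fin P.d) × Equiv.Perm (Fin P.d)) := Nat.cast_pos.mpr Fintype.card_pos
  field_simp

/-! ## §2 The coboundary potential of a pure gauge, explicitly -/

/-- **★★ THE (0.4) COBOUNDARY POTENTIAL OF A FINEST PURE GAUGE**: `Ψ_s(dg)(y) = (Q'_s g)(y) − g(toFine s y)` — the `s`-fold site average of the potential minus its value at the centre
(induction: `Ψ_{s+1} = Q'(Ψ_s) + Φ(linAvgIter s (dg))`, `linAvgIter s (dg) = d(g ∘ toFine s)`, `Φ(df) = Q' f − f ∘ emb`). [cite: Balaban1987RG1, (0.4)+(0.11) p.253] -/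
theorem psiIter_dgrad (g : Site P 0 → ℝ) : ∀ (s : ℕ) (y : Site P s), psiIter s (dgrad g) y = siteAvgIter s g y - g (toFine s y)
  | 0, y => by simp [psiIter, siteAvgIter]
  | s + 1, y => by
    have ih : psiIter s (dgrad g) = fun z => siteAvgIter s g z - g (toFine s z) := funext (psiIter_dgrad g s)
    show ptMean (psiIter s (dgrad g)) y + stairMean (linAvgIter s (dgrad g)) y = siteAvgIter (s + 1) g y - g (toFine (s + 1) y)
    rw [ih, linAvgIter_dgrad, stairMean_dgrad, toFine_succ,
      show (fun z => siteAvgIter s g z - g (toFine s z)) = siteAvgIter s g - g ∘ toFine s from rfl, ptMean_sub, ptMean_eq_siteAvg, ptMean_eq_siteAvg]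
    show siteAvg (siteAvgIter s g) y - siteAvg (g ∘ toFine s) y + (siteAvg (g ∘ toFine s) y - (g ∘ toFine s) (emb y)) = (siteAvg ∘ siteAvgIter s) g y - g (toFine s (emb y))
    simp only [Function.comp]
    ring

/-! ## §3 The spread of a 0-form is a right inverse of the `k`-fold site average -/

section Biorth

variable (k : ℕ) (hk : k ≤ P.m + P.K)
include hk

/-- The block sum of the tensor `σ`-profiles factorises and evaluates: `Σ_{x ∈ B^k(z)} Π_i Pσ(x_i, y_i) = n^d·[y = z]` (`Psig_cell` in every coordinate). [cite: Balaban1987RG1, (0.1) p.251] -/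
theorem blockSum_sigma_profiles (z y : Site P k) :
    ∑ x ∈ iterBlock k z, ∏ i, Psig (hh P k) (x i) (y i) = if y = z then ((side (hh P k) : ℝ)) ^ P.d else 0 := by
  have hN' := hN k hk
  rw [sum_iterBlock_eq hk]
  let G : Fin P.d → Fin (P.L ^ k) → ℝ := fun i t => Psig (hh P k) ((((z i).val * P.L ^ k + (t : ℕ) : ℕ)) : ZMod (P.sitesPerDir 0)) (y i)
  have hG : ∀ jj : Fin P.d → Fin (P.L ^ k), ∏ i, Psig (hh P k) (blockSiteK k z jj i) (y i) = ∏ i, G i (jj i) := fun jj => rfl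
  rw [sum_congr rfl fun jj _ => hG jj]
  have hfac : ∑ jj : Fin P.d → Fin (P.L ^ k), ∏ i, G i (jj i) = ∏ i, ∑ t : Fin (P.L ^ k), G i t := by
    rw [Finset.prod_univ_sum, Fintype.piFinset_univ]
  rw [hfac]
  have hcell : ∀ i, ∑ t : Fin (P.L ^ k), G i t = ∑ a ∈ cellFin (hh P k) (z i), Psig (hh P k) a (y i) :=
    fun i => (sum_cellFin_fin (hh P k) hN' (P.L ^ k) (hside k) (fun a => Psig (hh P k) a (y i)) (z i)).symm
  rw [prod_congr rfl fun i _ => hcell i]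
  have hi : ∀ i, ∑ a ∈ cellFin (hh P k) (z i), Psig (hh P k) a (y i) = if y i = z i then (side (hh P k) : ℝ) else 0 :=
    fun i => Psig_cell (hh P k) hN' (y i) (z i)
  rw [prod_congr rfl fun i _ => hi i]
  by_cases hyz : y = z
  · subst hyz
    simp only [if_true]
    rw [prod_const, card_univ, Fintype.card_fin]
  · rw [if_neg hyz]
    obtain ⟨i, hi'⟩ : ∃ i, y i ≠ z i := Function.ne_iff.mp hyz
    exact prod_eq_zero (mem_univ i) (if_neg hi')

/-- **★★ BIORTHOGONALITY FOR 0-FORMS**: `Q'_k (S0 k λ) = λ` — the `k`-fold site average of the spread of a coarse 0-form returns the 0-form EXACTLY.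
[cite: Balaban1984PropagatorsI, (1.20) p.20; Balaban1987RG1, (0.1) p.251] -/
theorem siteAvgIter_S0 (lam : Site P k → ℝ) : siteAvgIter k (S0 k lam) = lam := by
  funext y
  rw [siteAvgIter_eq_blockSum k hk]
  unfold S0
  rw [sum_comm]
  simp_rw [← mul_sum, blockSum_sigma_profiles k hk y, mul_ite, mul_zero]
  rw [sum_ite_eq', if_pos (mem_univ y), hside, smul_eq_mul]
  have hL : ((P.L : ℝ) ^ k) ^ P.d ≠ 0 := pow_ne_zero _ (pow_ne_zero _ (Nat.cast_ne_zero.mpr P.L_pos.ne'))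
  push_cast
  rw [← pow_mul, mul_comm P.d k, pow_mul]
  field_simp

end Biorth

/-! ## §4 The lift of a pure gauge -/

section PureGauge

variable (k : ℕ) (hk : k ≤ P.m + P.K)

/-- `S0 k 0 = 0`. [folklore] -/
theorem S0_zero : S0 k (0 : Site P k → ℝ) = 0 := by
  funext x; simp [S0]

/-- `d0 = 0`. [folklore] -/
theorem dgrad_zero' : dgrad (0 : Site P j → ℝ) = 0 := by
  funext b; simp [dgrad]

include hk

/-- **★★ THE COBOUNDARY POTENTIAL OF THE SPREAD OF A COARSE PURE GAUGE VANISHES**: `Ψ_k(S1 k (dλ)) = 0` (`S1 (dλ) = d(S0 λ)`, `Ψ_k(dg) = Q'_k g − g ∘ toFine k`, and both `Q'_k (S0 λ)` and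
`S0 λ ∘ toFine k` are `λ`). [cite: Balaban1987RG1, (0.4)+(0.11) p.253] -/
theorem psiIter_S1_dgrad (lam : Site P k → ℝ) : psiIter k (S1 k (dgrad lam)) = 0 := by
  rw [← dgrad_S0 k hk]
  funext y
  rw [psiIter_dgrad, siteAvgIter_S0 k hk, S0_toFine k hk]
  simp

/-- **★★★ THE SMOOTH LIFT OF A COARSE PURE GAUGE IS THE PURE GAUGE OF ITS `S0`-INTERPOLANT, EXACTLY**: `liftS k (dλ) = d(S0 k λ)` — with `S0 k λ (toFine k y) = λ y` at every coarse site
(`S0_toFine`): the finest gauge transformation relating two blockwise-frame candidates is trivial at the block centres. [cite: Balaban1987RG1, (0.4)+(0.11) p.253] -/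
theorem liftS_dgrad_eq (lam : Site P k → ℝ) : liftS k (dgrad lam) = dgrad (S0 k lam) := by
  unfold liftS
  rw [psiIter_S1_dgrad k hk, S0_zero, dgrad_zero', add_zero, dgrad_S0 k hk]

/-- **★ THE BLOCK-CONSTANT-GAUGE LIFT AGREES ON PURE GAUGES**: `lift k (dλ) = d(S0 k λ)` as well (its gauge term is `Ψ_k(S1(dλ)) ∘ coarsen = 0`). [cite: Balaban1987RG1, (0.4)+(0.11) p.253] -/
theorem lift_dgrad_eq (lam : Site P k → ℝ) : lift k (dgrad lam) = dgrad (S0 k lam) := by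
  unfold lift
  rw [psiIter_S1_dgrad k hk, dgrad_S0 k hk]
  funext b
  simp [dgrad]

end PureGauge

end Summit.QuantumFields.YangMills.Theorems.LinearLiftSpread

end
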